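import Summits.QuantumFields.YangMills.Theorems.LuscherReductionOneSiteLevelsPhase
import Summits.QuantumFields.YangMills.Theorems.LuscherReductionOneSiteLevelsAbsLower
import Literature.Analysis.OperatorTheory.YangMillsMatrixModelAL1Holds
import HarnessLib

/-!
# Route `LuscherReduction`, child item `OneSiteTail` (stmt-QuantumFields-20204): the COUNT-MODE COMPOSITION SEAM
# (INNER-count + OUTER-count ⟹ «OneSiteFemtoSubspaceBound», the hypothesis of `OSTailDoors.oneSiteTail_of_femtoSubspaceBound`)
# seat ym-cruxidea-19978-2 g11; TURNKEY for a prover (`--supports stmt-QuantumFields-20204`); def-free.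

ONE's `absUpper_of_localized k` (AbsUpperSeam) glued, at the FIXED threshold `E_k = physLevel (k+1)`, an INNER bound for the `cos Θ_B`-piece (with `k`
constraints) and an OUTER bound for the `sin Θ_B`-piece into `μ_k ≤ linkC³ e^{−E_kλ_b + Cλ_b²}`.  Here the same IMS seam (`qform_le_localized_cos_sin`,
`defect_scale`, `l2_cos_mul_add_l2_sin_mul`, `exp_add_mul_sq_le`) is run in COUNT MODE: the threshold is a femto energy `η ∈ [0, c₁ log B]` moving with
`B`, the constraints number `n ≤ C(1+η)^p`, and the output is normalised by `λ_0` through the closed crux ONE at `k = 0`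
(`oneSiteAbsLower_of_eigenfunctions (LuscherHamiltonianEigenfunctions_holds 0)`).  The «exponential-in-the-level» seam constant of ONE does not
appear: `ηλ_b ≤ (c₁+ε₁+1)·log B·λ_b → 0` (`exists_log_mul_bareLambda_le`).

★ `femtoSubspaceBound_of_inner_outer_count : INNERc → OUTERc → «OneSiteFemtoSubspaceBound»` where
  INNERc = `∀ c₁>0 ∃ C>0, p, C₁, B₁ ≥ 2: ∀ B ≥ B₁, ∀ η ∈ [0, c₁ log B], ∃ n ≤ C(1+η)^p physical φ_i: ∀ physical ψ ⊥ φ_i,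
            ⟨cos Θ_B ψ, K_B cos Θ_B ψ⟩ ≤ linkCE·e^{−ηλ_b + C₁λ_b²}‖cos Θ_B ψ‖²`  (`Θ_B = onePhase (onePhaseScale B)`),
  OUTERc = `∀ c₁>0 ∃ C₂, B₂ ≥ 2: ∀ B ≥ B₂, ∀ η ∈ [0, c₁ log B], ∀ physical ψ, ⟨sin Θ_B ψ, K_B sin Θ_B ψ⟩ ≤ linkCE·e^{−ηλ_b + C₂λ_b²}‖sin Θ_B ψ‖²`,
  «OneSiteFemtoSubspaceBound» = `∀ c₁>0 ∃ C>0, p, B0: ∀ B ≥ B0, ∀ E ∈ [0, c₁ log B], ∃ n ≤ C(1+E)^p physical φ_i: ∀ physical ψ ⊥ φ_i, 0 < ‖ψ‖² →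
            ⟨ψ, K_B ψ⟩ ≤ (e^{−λ_b E}·λ_0(B))·‖ψ‖²` — VERBATIM the hypothesis of `OSTailDoors.oneSiteTail_of_femtoSubspaceBound`
  (`LuscherReductionRunningReductionOneSiteTailDoors.lean`), which then yields the route item `OneSiteTail`.
HONEST FRAMING: bookkeeping only (INNERc/OUTERc are the analytic content: ONE's INNER/VALLEY/OUTER lanes re-run with thresholds up to `c₁ log B` and
constants polynomial in the threshold); femto rung R2b1; not a gap, not Clay.  Sorry-free; no `def`, no named-fact hypothesis.
References: [cite: SimonB1983DiscreteSpectrum, §3]; [cite: ReedSimonIV1978, Thm. XIII.1]; [cite: Luscher1983, §2].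
-/

set_option autoImplicit false

noncomputable section

open MeasureTheory Filter Topology Real
open Literature.MathematicalPhysics.QuantumFieldTheory
open Literature.MathematicalPhysics.QuantumLattice
open Literature.Analysis.OperatorTheory.YMMatrixModel

namespace Summit.QuantumFields.YangMills.Theorems.FemtoTransferGap.OSTailSeam

/-- `λ_b(B) ≤ 2·B^{−1/3}` for `B > 0` (`λ_b = (2/B)^{1/3}`, `2^{1/3} ≤ 2`). [cite: Luscher1983, §1] -/
theorem bareLambda_le_two_div_rpow {B : ℝ} (hB : 0 < B) : bareLambda B ≤ 2 / B ^ ((1 : ℝ) / 3) := by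
  unfold bareLambda
  rw [Real.div_rpow (by norm_num : (0:ℝ) ≤ 2) hB.le]
  have h2 : (2 : ℝ) ^ ((1 : ℝ) / 3) ≤ 2 := by
    calc (2 : ℝ) ^ ((1 : ℝ) / 3) ≤ (2 : ℝ) ^ (1 : ℝ) :=
          Real.rpow_le_rpow_of_exponent_le (by norm_num) (by norm_num)
      _ = 2 := Real.rpow_one 2
  exact div_le_div_of_nonneg_right h2 (Real.rpow_pos_of_pos hB _).le

/-- **`log B · λ_b(B) → 0`, quantified**: for every `K`, `K·log B·λ_b(B) ≤ 1` for all large `B` (`log B = o(B^{1/3})`). [folklore] -/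
theorem exists_log_mul_bareLambda_le (K : ℝ) : ∃ B0 : ℝ, ∀ B : ℝ, B0 ≤ B → K * Real.log B * bareLambda B ≤ 1 := by
  have h := (isLittleO_log_rpow_atTop (by norm_num : (0:ℝ) < 1 / 3)).tendsto_div_nhds_zero
  have h2 : Tendsto (fun B : ℝ => |K| * 2 * (Real.log B / B ^ ((1 : ℝ) / 3))) atTop (𝓝 (|K| * 2 * 0)) := h.const_mul _
  rw [mul_zero] at h2
  have hev : ∀ᶠ B : ℝ in atTop, |K| * 2 * (Real.log B / B ^ ((1 : ℝ) / 3)) < 1 := h2.eventually (Iio_mem_nhds one_pos)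
  obtain ⟨B1, hB1⟩ := Filter.eventually_atTop.1 (hev.and (Filter.eventually_ge_atTop 1))
  refine ⟨B1, fun B hB => ?_⟩
  obtain ⟨hlt, hB1'⟩ := hB1 B hB
  have hBpos : 0 < B := by linarith
  have hlog : 0 ≤ Real.log B := Real.log_nonneg hB1'
  have hl0 : 0 ≤ bareLambda B := (bareLambda_pos' hBpos).le
  have hrp : 0 < B ^ ((1 : ℝ) / 3) := Real.rpow_pos_of_pos hBpos _
  calc K * Real.log B * bareLambda B ≤ |K| * Real.log B * bareLambda B := by
        have := mul_le_mul_of_nonneg_right (mul_le_mul_of_nonneg_right (le_abs_self K) hlog) hl0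
        exact this
    _ ≤ |K| * Real.log B * (2 / B ^ ((1 : ℝ) / 3)) :=
        mul_le_mul_of_nonneg_left (bareLambda_le_two_div_rpow hBpos) (mul_nonneg (abs_nonneg K) hlog)
    _ = |K| * 2 * (Real.log B / B ^ ((1 : ℝ) / 3)) := by
        field_simp
    _ ≤ 1 := hlt.le

/-- ★ **COUNT-MODE COMPOSITION SEAM.**  INNER-count (the `cos Θ_B`-piece of every physical `ψ ⊥ φ_i` for `n ≤ C(1+η)^p` physical constraints, at every
threshold `η ≤ c₁ log B`) and OUTER-count (the `sin Θ_B`-piece of every physical `ψ`, same thresholds) give «OneSiteFemtoSubspaceBound» — the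
hypothesis of `OSTailDoors.oneSiteTail_of_femtoSubspaceBound`, verbatim.  Proof: IMS with the one-phase partition at link scale `ℓ = λ_b^{1/2}`
(`qform_le_localized_cos_sin` + `defect_scale`, defect `(9/8)(π²/4)cM2·λ_b²·linkCE‖ψ‖²`), absorption `e^{a} + Dλ² ≤ e^{a + MDλ²}` with `M = e^{1+|C'|}`
(valid because `ηλ_b ≤ 1` for large `B`), threshold shift `η = E + ε₁ + 1` against `λ_0 ≥ linkC³e^{−ε₁λ_b − C_Aλ_b²}` (closed crux ONE at `k = 0`).
[cite: SimonB1983DiscreteSpectrum, §3] [cite: ReedSimonIV1978, Thm. XIII.1] [cite: Luscher1983, §2] -/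
theorem femtoSubspaceBound_of_inner_outer_count
    (hin : ∀ c₁ : ℝ, 0 < c₁ → ∃ C : ℝ, ∃ p : ℕ, ∃ C₁ B₁ : ℝ, 0 < C ∧ 2 ≤ B₁ ∧ ∀ B : ℝ, B₁ ≤ B → ∀ η : ℝ, 0 ≤ η → η ≤ c₁ * Real.log B →
      ∃ n : ℕ, (n : ℝ) ≤ C * (1 + η) ^ p ∧ ∃ φs : Fin n → (GaugeConfig 3 1 SU2 → ℝ), (∀ i, IsPhys (φs i)) ∧
        ∀ ψ : GaugeConfig 3 1 SU2 → ℝ, IsPhys ψ → (∀ i, l2 ψ (φs i) = 0) →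
          qform su2Rep B (fun U => Real.cos (onePhase (onePhaseScale B) U) * ψ U) (fun U => Real.cos (onePhase (onePhaseScale B) U) * ψ U)
            ≤ linkCE B * Real.exp (-(η * bareLambda B) + C₁ * bareLambda B ^ 2)
              * l2 (fun U => Real.cos (onePhase (onePhaseScale B) U) * ψ U) (fun U => Real.cos (onePhase (onePhaseScale B) U) * ψ U))
    (hout : ∀ c₁ : ℝ, 0 < c₁ → ∃ C₂ B₂ : ℝ, 2 ≤ B₂ ∧ ∀ B : ℝ, B₂ ≤ B → ∀ η : ℝ, 0 ≤ η → η ≤ c₁ * Real.log B →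
      ∀ ψ : GaugeConfig 3 1 SU2 → ℝ, IsPhys ψ →
        qform su2Rep B (fun U => Real.sin (onePhase (onePhaseScale B) U) * ψ U) (fun U => Real.sin (onePhase (onePhaseScale B) U) * ψ U)
          ≤ linkCE B * Real.exp (-(η * bareLambda B) + C₂ * bareLambda B ^ 2)
            * l2 (fun U => Real.sin (onePhase (onePhaseScale B) U) * ψ U) (fun U => Real.sin (onePhase (onePhaseScale B) U) * ψ U)) :
    ∀ c₁ : ℝ, 0 < c₁ → ∃ C : ℝ, ∃ p : ℕ, ∃ B0 : ℝ, 0 < C ∧ ∀ B : ℝ, B0 ≤ B → ∀ E : ℝ, 0 ≤ E → E ≤ c₁ * Real.log B →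
      ∃ n : ℕ, (n : ℝ) ≤ C * (1 + E) ^ p ∧ ∃ φs : Fin n → (GaugeConfig 3 1 SU2 → ℝ), (∀ i, IsPhys (φs i)) ∧
        ∀ ψ : GaugeConfig 3 1 SU2 → ℝ, IsPhys ψ → (∀ i, l2 ψ (φs i) = 0) → 0 < l2 ψ ψ →
          qform su2Rep B ψ ψ ≤ (Real.exp (-(bareLambda B * E)) * levelValue su2Rep 1 B 0) * l2 ψ ψ := by
  intro c₁ hc₁
  -- the closed crux ONE at `k = 0`: `λ_0 ≥ linkC³ e^{−ε₁λ_b − C_Aλ_b²}`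
  obtain ⟨CA, BA, hAL⟩ := oneSiteAbsLower_of_eigenfunctions (LuscherHamiltonianEigenfunctions_holds 0)
  have hε0 : 0 ≤ physLevel (0 + 1) := physLevel_nonneg (by norm_num)
  set ε₁ : ℝ := physLevel (0 + 1) with hε₁
  -- thresholds up to `c₁' log B`, `c₁' = c₁ + ε₁ + 1`
  set c₁' : ℝ := c₁ + ε₁ + 1 with hc₁'
  have hc₁'pos : 0 < c₁' := by rw [hc₁']; linarith
  obtain ⟨C, p, C₁, B₁, hC, hB₁, hinB⟩ := hin c₁' hc₁'pos
  obtain ⟨C₂, B₂, hB₂, houtB⟩ := hout c₁' hc₁'pos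
  obtain ⟨BL, hBL⟩ := exists_log_mul_bareLambda_le c₁'
  -- constants
  set C' : ℝ := max C₁ C₂ with hC'
  set D : ℝ := 9 / 4 * (Real.pi ^ 2 / 4) * cM2 with hD
  have hD0 : 0 ≤ D := by rw [hD]; have := cM2_pos; positivity
  set M : ℝ := Real.exp (1 + |C'|) with hM
  have hM0 : 0 < M := Real.exp_pos _
  have hMD : 0 ≤ M * D := mul_nonneg hM0.le hD0
  set Ctot : ℝ := |C'| + M * D + |CA| + 1 with hCtot
  have hCtot0 : 0 < Ctot := by
    rw [hCtot]; linarith [abs_nonneg C', abs_nonneg CA]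
  refine ⟨C * (2 + ε₁) ^ p, p, max (max (max B₁ B₂) (max BA BL)) (max (Real.exp 1) (2 / (1 / Ctot) ^ 3)), by positivity,
    fun B hB E hE hEc => ?_⟩
  -- unpack `B ≥ B0`
  have hBB₁ : B₁ ≤ B := le_trans (le_trans (le_max_left _ _) (le_max_left _ _)) (le_trans (le_max_left _ _) hB)
  have hBB₂ : B₂ ≤ B := le_trans (le_trans (le_max_right _ _) (le_max_left _ _)) (le_trans (le_max_left _ _) hB)
  have hBBA : BA ≤ B := le_trans (le_trans (le_max_left _ _) (le_max_right _ _)) (le_trans (le_max_left _ _) hB)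
  have hBBL : BL ≤ B := le_trans (le_trans (le_max_right _ _) (le_max_right _ _)) (le_trans (le_max_left _ _) hB)
  have hBe : Real.exp 1 ≤ B := le_trans (le_max_left _ _) (le_trans (le_max_right _ _) hB)
  have hBC : 2 / (1 / Ctot) ^ 3 ≤ B := le_trans (le_max_right _ _) (le_trans (le_max_right _ _) hB)
  have hB2 : 2 ≤ B := hB₁.trans hBB₁
  have hBpos : 0 < B := by linarith
  obtain ⟨hl0, hl1⟩ := bareLambda_pos_le_one hB2
  set x := bareLambda B with hx
  have hxC : x ≤ 1 / Ctot := bareLambda_le_of_le (by positivity) hBC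
  have hxCtot : Ctot * x ≤ 1 := by
    have := mul_le_mul_of_nonneg_left hxC hCtot0.le
    rwa [mul_one_div_cancel hCtot0.ne'] at this
  have hlogB : 1 ≤ Real.log B := by
    rw [← Real.log_exp 1]
    exact Real.log_le_log (Real.exp_pos 1) hBe
  -- the threshold `η = E + ε₁ + 1 ∈ [0, c₁' log B]`
  set η : ℝ := E + ε₁ + 1 with hη
  have hη0 : 0 ≤ η := by rw [hη]; linarith
  have hηc : η ≤ c₁' * Real.log B := by
    have h7 : (ε₁ + 1) * 1 ≤ (ε₁ + 1) * Real.log B := mul_le_mul_of_nonneg_left hlogB (by linarith)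
    have h8 : c₁' * Real.log B = c₁ * Real.log B + (ε₁ + 1) * Real.log B := by rw [hc₁']; ring
    rw [h8, hη]; linarith
  have hηx : η * x ≤ 1 := by
    calc η * x ≤ c₁' * Real.log B * x := mul_le_mul_of_nonneg_right hηc hl0.le
      _ ≤ 1 := hBL B hBBL
  -- the constraints
  obtain ⟨n, hn, φs, hφ, hinψ⟩ := hinB B hBB₁ η hη0 hηc
  refine ⟨n, ?_, φs, hφ, fun ψ hψ horth _ => ?_⟩
  · -- `n ≤ C(1+η)^p ≤ C(2+ε₁)^p (1+E)^p`
    have h1 : 1 + η ≤ (2 + ε₁) * (1 + E) := by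
      have h0 : 0 ≤ ε₁ * E := mul_nonneg hε0 hE
      have hex : (2 + ε₁) * (1 + E) = 2 + ε₁ + E + (E + ε₁ * E) := by ring
      rw [hη, hex]; linarith
    have h2 : (1 + η) ^ p ≤ ((2 + ε₁) * (1 + E)) ^ p := pow_le_pow_left₀ (by linarith) h1 p
    calc (n : ℝ) ≤ C * (1 + η) ^ p := hn
      _ ≤ C * ((2 + ε₁) * (1 + E)) ^ p := mul_le_mul_of_nonneg_left h2 hC.le
      _ = C * (2 + ε₁) ^ p * (1 + E) ^ p := by rw [mul_pow]; ring
  -- IMS with the one-phase partition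
  have hims := qform_le_localized_cos_sin hBpos (measurable_onePhase _) (Λ := Real.pi / 2 / onePhaseScale B)
    (div_nonneg (by positivity) (onePhaseScale_pos hBpos).le) (abs_onePhase_sub_le (onePhaseScale_pos hBpos))
    (onePhase_gaugeTransform _) (fun k z hz U => onePhase_twist _ k hz U) hψ
  have hscale := defect_scale hBpos (onePhaseScale_lipschitzSq hBpos)
  have hsum := l2_cos_mul_add_l2_sin_mul (measurable_onePhase (onePhaseScale B)) hψ
  have hCE : linkCE B = linkC B ^ 3 := by rw [linkCE, card_edge_one]
  have hc0 : 0 < linkC B ^ 3 := pow_pos (linkC_pos hBpos.le) 3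
  have hCE0 : 0 ≤ linkCE B := by rw [hCE]; exact hc0.le
  -- common rate `a = −ηx + C'x²`
  set a : ℝ := -(η * x) + C' * x ^ 2 with ha
  have hrate : ∀ {Cc : ℝ}, Cc ≤ C' → linkCE B * Real.exp (-(η * x) + Cc * x ^ 2) ≤ linkCE B * Real.exp a := by
    intro Cc hCc
    refine mul_le_mul_of_nonneg_left (Real.exp_le_exp.mpr ?_) hCE0
    rw [ha]
    exact add_le_add le_rfl (mul_le_mul_of_nonneg_right hCc (sq_nonneg x))
  set nc := l2 (fun U => Real.cos (onePhase (onePhaseScale B) U) * ψ U) (fun U => Real.cos (onePhase (onePhaseScale B) U) * ψ U) with hnc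
  set ns := l2 (fun U => Real.sin (onePhase (onePhaseScale B) U) * ψ U) (fun U => Real.sin (onePhase (onePhaseScale B) U) * ψ U) with hns
  set N := l2 ψ ψ with hN
  have hN0 : 0 ≤ N := by rw [hN]; unfold l2; exact integral_nonneg fun U => mul_self_nonneg _
  have hnc0 : 0 ≤ nc := by rw [hnc]; unfold l2; exact integral_nonneg fun U => mul_self_nonneg _
  have hns0 : 0 ≤ ns := by rw [hns]; unfold l2; exact integral_nonneg fun U => mul_self_nonneg _
  have h1 : qform su2Rep B (fun U => Real.cos (onePhase (onePhaseScale B) U) * ψ U)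
      (fun U => Real.cos (onePhase (onePhaseScale B) U) * ψ U) ≤ linkCE B * Real.exp a * nc :=
    (hinψ ψ hψ horth).trans (mul_le_mul_of_nonneg_right (hrate (le_max_left _ _)) hnc0)
  have h2 : qform su2Rep B (fun U => Real.sin (onePhase (onePhaseScale B) U) * ψ U)
      (fun U => Real.sin (onePhase (onePhaseScale B) U) * ψ U) ≤ linkCE B * Real.exp a * ns :=
    (houtB B hBB₂ η hη0 hηc ψ hψ).trans (mul_le_mul_of_nonneg_right (hrate (le_max_right _ _)) hns0)
  -- error coefficient ≤ D x² linkCE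
  have herr : (1 / 2) * (9 * (Real.pi / 2 / onePhaseScale B) ^ 2 * (cM2 / B) * linkCE B) * N ≤ linkCE B * (D * x ^ 2) * N := by
    have : (1 / 2) * (9 * (Real.pi / 2 / onePhaseScale B) ^ 2 * (cM2 / B)) ≤ D * x ^ 2 := by rw [hD]; linarith
    calc (1 / 2) * (9 * (Real.pi / 2 / onePhaseScale B) ^ 2 * (cM2 / B) * linkCE B) * N
        = ((1 / 2) * (9 * (Real.pi / 2 / onePhaseScale B) ^ 2 * (cM2 / B))) * linkCE B * N := by ring
      _ ≤ (D * x ^ 2) * linkCE B * N := mul_le_mul_of_nonneg_right (mul_le_mul_of_nonneg_right this hCE0) hN0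
      _ = linkCE B * (D * x ^ 2) * N := by ring
  have hmain : qform su2Rep B ψ ψ ≤ linkCE B * (Real.exp a + D * x ^ 2) * N := by
    calc qform su2Rep B ψ ψ ≤ linkCE B * Real.exp a * nc + linkCE B * Real.exp a * ns
          + (1 / 2) * (9 * (Real.pi / 2 / onePhaseScale B) ^ 2 * (cM2 / B) * linkCE B) * N := by linarith [hims, h1, h2]
      _ = linkCE B * Real.exp a * N + (1 / 2) * (9 * (Real.pi / 2 / onePhaseScale B) ^ 2 * (cM2 / B) * linkCE B) * N := by
          rw [← hsum]; ring
      _ ≤ linkCE B * Real.exp a * N + linkCE B * (D * x ^ 2) * N := by linarith [herr]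
      _ = linkCE B * (Real.exp a + D * x ^ 2) * N := by ring
  -- absorb `D x²` into the exponent: `e^{−a} ≤ M = e^{1+|C'|}` since `ηx ≤ 1`, `x ≤ 1`
  have hMbd : Real.exp (-a) ≤ M := by
    rw [hM]
    apply Real.exp_le_exp.mpr
    rw [ha]
    have h4 : -(C' * x ^ 2) ≤ |C'| := by
      have hx2 : x ^ 2 ≤ 1 := pow_le_one₀ hl0.le hl1
      have h9 : -C' * x ^ 2 ≤ |C'| * x ^ 2 := mul_le_mul_of_nonneg_right (neg_le_abs C') (sq_nonneg x)
      rw [neg_mul] at h9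
      calc -(C' * x ^ 2) ≤ |C'| * x ^ 2 := h9
        _ ≤ |C'| * 1 := mul_le_mul_of_nonneg_left hx2 (abs_nonneg _)
        _ = |C'| := mul_one _
    have h10 : -(-(η * x) + C' * x ^ 2) = η * x + -(C' * x ^ 2) := by ring
    rw [h10]
    linarith [hηx, h4]
  have habs := exp_add_mul_sq_le (x := x) hD0 hMbd
  -- the exponent comparison: `a + MDx² ≤ −Ex − ε₁x − C_A x²` because `(C' + MD + C_A)x ≤ Ctot·x ≤ 1`
  have hexp : a + M * D * x ^ 2 ≤ -(x * E) + (-(ε₁ * x) - CA * x ^ 2) := by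
    rw [ha, hη]
    have hkey : (C' + M * D + CA) * x ≤ 1 := by
      have h5 : C' + M * D + CA ≤ Ctot := by
        rw [hCtot]; linarith [le_abs_self C', le_abs_self CA]
      calc (C' + M * D + CA) * x ≤ Ctot * x := mul_le_mul_of_nonneg_right h5 hl0.le
        _ ≤ 1 := hxCtot
    have h6 : (C' + M * D + CA) * x * x ≤ 1 * x := mul_le_mul_of_nonneg_right hkey hl0.le
    have hex : -((E + ε₁ + 1) * x) + C' * x ^ 2 + M * D * x ^ 2
        = (-(x * E) + (-(ε₁ * x) - CA * x ^ 2)) + ((C' + M * D + CA) * x * x - 1 * x) := by ring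
    rw [hex]
    linarith
  have hlam0 := hAL B hBBA
  -- assemble
  calc qform su2Rep B ψ ψ ≤ linkCE B * (Real.exp a + D * x ^ 2) * N := hmain
    _ ≤ linkCE B * Real.exp (a + M * D * x ^ 2) * N :=
        mul_le_mul_of_nonneg_right (mul_le_mul_of_nonneg_left habs hCE0) hN0
    _ ≤ linkCE B * Real.exp (-(x * E) + (-(ε₁ * x) - CA * x ^ 2)) * N :=
        mul_le_mul_of_nonneg_right (mul_le_mul_of_nonneg_left (Real.exp_le_exp.mpr hexp) hCE0) hN0
    _ = Real.exp (-(x * E)) * (linkC B ^ 3 * Real.exp (-(ε₁ * x) - CA * x ^ 2)) * N := by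
        rw [Real.exp_add, hCE]; ring
    _ ≤ Real.exp (-(x * E)) * levelValue su2Rep 1 B 0 * N := by
        refine mul_le_mul_of_nonneg_right (mul_le_mul_of_nonneg_left ?_ (Real.exp_pos _).le) hN0
        rw [hx]; exact hlam0
    _ = (Real.exp (-(bareLambda B * E)) * levelValue su2Rep 1 B 0) * l2 ψ ψ := by rw [hx, hN]

end Summit.QuantumFields.YangMills.Theorems.FemtoTransferGap.OSTailSeam

end
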